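import Mathlib.FieldTheory.Normal.Closure
import Mathlib.FieldTheory.AlgebraicClosure
import Mathlib.FieldTheory.Galois.Basic
import Mathlib.FieldTheory.IsAlgClosed.Basic
import Mathlib.RingTheory.Jacobson.Ring
import HarnessLib

/-!
# A closed point of a finitely generated algebra over a perfect field `k`, read in a finite Galois extension of `k`
# inside an algebraically closed overfield (Zariski's lemma + normal closure)

Topic `Literature/FieldTheory/Galois`, namespace `Literature.FieldTheory.Galois` (spreading-out / specialisation bookkeeping).  Cell `hodgecm-mathlib` (D-0151), row III-0, A-p14's road memo
`ROAD-III0-albanese-baseChange.md` step (S5) «closed point + Galois level»: for a NONTRIVIAL finitely generated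
`k`-algebra `T` (`k` perfect, e.g. of characteristic zero) and an algebraically closed field `E ⊇ k` (e.g. `ℂ`), there is a
FINITE GALOIS subextension `L ⊆ E` of `k` together with a `k`-algebra homomorphism `T → L` (the residue field of a maximal
ideal is finite over `k` by Zariski's lemma / the Nullstellensatz, Mathlib `finite_of_finite_type_of_isJacobsonRing`; embed
it into the algebraic closure of `k` in `E`, take the normal closure there, and push into `E`).  This is the Galois level
at which the special fibre of a spread abelian scheme is read.  PROVED here, Mathlib only (theorems only; no definition,
no named fact).

## References
* [GortzWedhorn2020] U. Görtz, T. Wedhorn, *Algebraic Geometry I*, 2nd ed. (2020), Prop. 3.33 (closed points have residue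
  fields finite over `k`), Thm. 1.7 (Nullstellensatz).
* [StacksProject] The Stacks project, Tag 00FV (Zariski's lemma), Tag 0BMF (normal closure).
-/

namespace Literature.FieldTheory.Galois

/-- **Residue fields of closed points, read in a finite Galois level.**  Let `k` be a perfect field, `E ⊇ k` algebraically
closed, and `T` a nontrivial finitely generated `k`-algebra.  Then there are a finite Galois subextension `L ⊆ E` of `k`
(an `IntermediateField k E`) and a `k`-algebra homomorphism `T → L`.  Proof: a maximal ideal `𝔪 ⊂ T`; `κ = T ⧸ 𝔪` is a
field of finite type, hence finite, over `k` (Zariski's lemma, Mathlib `finite_of_finite_type_of_isJacobsonRing`); embed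
`κ` into the algebraic closure `k̄ ⊆ E` of `k` (`IsAlgClosed.lift`), take the normal closure of `κ / k` in `k̄`
(finite, normal, separable as `k` is perfect), and push it into `E` (`IntermediateField.lift`).
[cite: GortzWedhorn2020, Prop. 3.33 and Thm. 1.7] [cite: StacksProject, Tag 00FV and Tag 0BMF] -/
theorem exists_algHom_finite_galois_intermediateField {k : Type*} [Field k] [PerfectField k]
    {E : Type*} [Field E] [Algebra k E] [IsAlgClosed E]
    (T : Type*) [CommRing T] [Nontrivial T] [Algebra k T] [Algebra.FiniteType k T] :
    ∃ (L : IntermediateField k E) (_ : FiniteDimensional k L) (_ : IsGalois k L), Nonempty (T →ₐ[k] L) := by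
  classical
  -- a closed point: a maximal ideal and its residue field, finite over `k`
  obtain ⟨𝔪, h𝔪⟩ := Ideal.exists_maximal T
  letI : 𝔪.IsMaximal := h𝔪
  let κ := T ⧸ 𝔪
  letI : Field κ := Ideal.Quotient.field 𝔪
  haveI : Algebra.FiniteType k κ := Algebra.FiniteType.trans (S := T) inferInstance inferInstance
  haveI : Module.Finite k κ := finite_of_finite_type_of_isJacobsonRing k κ
  haveI : Algebra.IsAlgebraic k κ := Algebra.IsAlgebraic.of_finite k κ
  -- the algebraic closure of `k` inside `E` and an embedding of `κ`
  let Ω : IntermediateField k E := algebraicClosure k E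
  haveI : IsAlgClosed Ω := IsAlgClosure.isAlgClosed k
  let ι : κ →ₐ[k] Ω := IsAlgClosed.lift
  -- the normal closure of `κ / k` in `Ω`: finite Galois over `k`
  haveI : Nonempty (κ →ₐ[k] Ω) := ⟨ι⟩
  let N : IntermediateField k Ω := IntermediateField.normalClosure k κ Ω
  haveI : FiniteDimensional k N := normalClosure.is_finiteDimensional k κ Ω
  haveI : Normal k N := normalClosure.normal k κ Ω
  haveI : Algebra.IsSeparable k N := Algebra.IsAlgebraic.isSeparable_of_perfectField
  haveI : IsGalois k N := IsGalois.mk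
  -- push into `E`
  refine ⟨IntermediateField.lift N, ?_, ?_, ⟨?_⟩⟩
  · exact LinearEquiv.finiteDimensional (IntermediateField.liftAlgEquiv N).toLinearEquiv
  · exact IsGalois.of_algEquiv (IntermediateField.liftAlgEquiv N)
  · exact ((IntermediateField.liftAlgEquiv N).toAlgHom.comp
      ((IntermediateField.inclusion ι.fieldRange_le_normalClosure).comp ι.rangeRestrict)).comp
        (Ideal.Quotient.mkₐ k 𝔪)

end Literature.FieldTheory.Galois
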